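import Summits.Langlands.Langlands.Theorems.IrreducibilityBySelfDualityPairLBoundaryJS
import Summits.Langlands.Langlands.Theorems.IrreducibilityBySelfDualityPairLBoundaryJSSsv
import Summits.Langlands.Langlands.Theorems.IrreducibilityBySelfDualityPairLBoundaryJSStandardEntire
import Summits.Langlands.Langlands.Theorems.IrreducibilityBySelfDualityPairLBoundaryJSIsOrthoOfLocalTranslate
import Summits.Langlands.Langlands.Theorems.IrreducibilityBySelfDualityPairLBoundaryJSEqConjOfLocalTranslate
import Summits.Langlands.Langlands.Theorems.IrreducibilityBySelfDualityPairLBoundaryJSLocalPairTranslate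
import Literature.NumberTheory.Automorphic.PairLFunctionMeromorphicContinuationRankNeTwistProofs

/-!
# Crux `PairLBoundaryJS` (stmt-Langlands-13622), line `Sketch` — the crux from TWO named inputs

Summit `Langlands`, sub-problem `Langlands`, helper file under `Theorems/` supporting the crux
`PairLBoundaryJS` = Arthur–Clozel (1989), Ch. 3, (2.2) for cuspidal Borel–Jacquet data on `GL_n × GL_m`
over a number field, all ranks (lead c3). This is the line's skeleton v12 with every engineering stub
LANDED, so that the composition `PairLBoundaryJS_of_moeglinWaldspurger_of_isOrtho hA hC hB` (p81600)
becomes an honest CONDITIONAL theorem on exactly two printed inputs: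

* `hMW` — Mœglin–Waldspurger (1989), Appendice, Corollaire (i)(a) for `2 ≤ n, m`, `n ≠ m`
  (`L^S(s, π × σ)` entire; Jacquet–Piatetski-Shapiro–Shalika (1983) / Cogdell (2004) Thm. 4.2 by the
  global integrals with the projector `ℙⁿ_m` — the `GL_n × GL_m` Rankin–Selberg theory, not in the tree);
* `hHJ` — the archimedean named fact `HumphriesJo2024_archRankinSelberg_testVector` (Humphries–Jo
  (2024) Thm. 1.1 / 5.6 with Jacquet–Shalika's archimedean convergence).

Everything else is proved in the tree by the line: the `(n,1)`, `(1,n)` slices of (i)(a)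
(`StandardEntire.stub_standard_entire_of_ssv Ssv.stub_ssv`), the local Rankin–Selberg theory of a
cuspidal pair in translate form (`LocalPairTranslate.stub_local_pair_translate`, from `hHJ`), and its two
consumers — Mœglin–Waldspurger (ii) (`EqConjOfLocalTranslate.stub_eq_conj_of_local_translate`) and the
orthogonal-pair continuation (`IsOrthoOfLocalTranslate.stub_isOrtho_of_local_translate`). In particular
Mœglin–Waldspurger (1989), Appendice, Corollaire (ii) — `s (s - 1) L^S(s, π × π̃)` is entire, every rank,
every number field — is a theorem of the tree GRANTED ONLY the archimedean fact
(`partialPairL_of_eq_conj_of_humphriesJo`), and so is Corollaire (i)(b) in orthogonal form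
(`partialPairL_entire_of_isOrtho_of_humphriesJo`).
-/

noncomputable section

-- `Summit.Langlands.Langlands.…` (summit = sub-problem name, D-0017 layout) trips `dupNamespace`
set_option linter.dupNamespace false

open scoped MatrixGroups Topology InnerProductSpace
open NumberField IsDedekindDomain MeasureTheory Measure Set Filter
open Literature.NumberTheory.Automorphic AdelicGroupData

-- the automorphic quotient carries the tree's Borel σ-algebra, not Mathlib's quotient σ-algebra
attribute [-instance] Quotient.instMeasurableSpace QuotientGroup.measurableSpace

namespace Summit.Langlands.Langlands.Theorems.PairLBoundaryJSOfHumphriesJo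

/-- **Mœglin–Waldspurger (1989), Appendice, Corollaire (ii), every rank and number field, from the
archimedean named fact alone**: for cuspidal `π = σ̄` on `GL_n(𝔸_K)`, every finite `S` and Satake
families off `S`, `s (s - 1) L^S(s, π ⊗ σ)` extends to an entire function
(`EqConjOfLocalTranslate.stub_eq_conj_of_local_translate` on `LocalPairTranslate.stub_local_pair_translate`).
[cite: MoeglinWaldspurger1989, Appendice, Corollaire (ii), p. 667] [cite: CogdellAnalyticTheory2004, Thm. 4.2 and §4.2]
[cite: HumphriesJo2024, Thm. 1.1 and Thm. 5.6] -/
theorem partialPairL_of_eq_conj_of_humphriesJo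
    (hHJ : ∀ (N : ℕ) (K : Type) [Field K] [NumberField K], HumphriesJo2024_archRankinSelberg_testVector N K)
    {n : ℕ} {K : Type} [Field K] [NumberField K]
    {μ : Measure (AdelicGroupData.gl n K).automorphicQuotient} [(AdelicGroupData.gl n K).IsAutomorphicMeasure μ] :
    MoeglinWaldspurger1989_partialPairL_of_eq_conj (n := n) (K := K) (μ := μ) :=
  EqConjOfLocalTranslate.stub_eq_conj_of_local_translate (LocalPairTranslate.stub_local_pair_translate hHJ)

/-- **Mœglin–Waldspurger (1989), Appendice, Corollaire (i)(b) in orthogonal form, every rank and number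
field, from the archimedean named fact alone**: for cuspidal `π ⟂ σ̄` in one `L²_cusp(GL_n)` (`0 < n`),
every finite `S` and Satake families off `S`, `L^S(s, π ⊗ σ)` extends to an entire function
(`IsOrthoOfLocalTranslate.stub_isOrtho_of_local_translate` on `LocalPairTranslate.stub_local_pair_translate`).
[cite: MoeglinWaldspurger1989, Appendice, Corollaire (i)(b), p. 667] [cite: CogdellAnalyticTheory2004, Thm. 4.2 and §4.2]
[cite: HumphriesJo2024, Thm. 1.1 and Thm. 5.6] -/
theorem partialPairL_entire_of_isOrtho_of_humphriesJo
    (hHJ : ∀ (N : ℕ) (K : Type) [Field K] [NumberField K], HumphriesJo2024_archRankinSelberg_testVector N K)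
    {n : ℕ} {K : Type} [Field K] [NumberField K]
    {μ : Measure (AdelicGroupData.gl n K).automorphicQuotient} [(AdelicGroupData.gl n K).IsAutomorphicMeasure μ]
    (hn : 0 < n) (P P' : CuspidalAutomorphicRepGL n K μ) (hor : P.1.toSubmodule ⟂ P'.conj.1.toSubmodule)
    {S : Set (HeightOneSpectrum (𝓞 K))} (hS : S.Finite) {α β : SatakeFamily K}
    (hα : IsSatakeFamilyOf P S α) (hβ : IsSatakeFamilyOf P' S β) :
    ∃ g : ℂ → ℂ, Differentiable ℂ g ∧ ∀ s : ℂ, 1 < s.re → g s = partialPairL S α β s :=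
  IsOrthoOfLocalTranslate.stub_isOrtho_of_local_translate (LocalPairTranslate.stub_local_pair_translate hHJ)
    hn P P' hor hS hα hβ

/-- **Mœglin–Waldspurger (1989), Appendice, Corollaire (i)(a) at all ranks from its `2 ≤ n, m` cases**:
`(n,1)` and `(1,n)` are theorems of the tree (`StandardEntire.stub_standard_entire_of_ssv Ssv.stub_ssv`
through `MoeglinWaldspurger1989_partialPairL_entire_of_rank_ne_gl_one_of_standard` and `…_of_swap`).
[cite: MoeglinWaldspurger1989, Appendice, Corollaire (i)(a), p. 667] [cite: CogdellAnalyticTheory2004, Thm. 4.2 and §4.2] -/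
theorem partialPairL_entire_of_rank_ne_of_two_le
    (hMW : ∀ {n m : ℕ} {K : Type} [Field K] [NumberField K]
      {μ : Measure (gl n K).automorphicQuotient} [(gl n K).IsAutomorphicMeasure μ]
      {μ' : Measure (gl m K).automorphicQuotient} [(gl m K).IsAutomorphicMeasure μ'],
      2 ≤ n → 2 ≤ m →
      MoeglinWaldspurger1989_partialPairL_entire_of_rank_ne (n := n) (m := m) (K := K) (μ := μ) (μ' := μ'))
    {n m : ℕ} {K : Type} [Field K] [NumberField K]
    {μ : Measure (gl n K).automorphicQuotient} [(gl n K).IsAutomorphicMeasure μ]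
    {μ' : Measure (gl m K).automorphicQuotient} [(gl m K).IsAutomorphicMeasure μ'] :
    MoeglinWaldspurger1989_partialPairL_entire_of_rank_ne (n := n) (m := m) (K := K) (μ := μ) (μ' := μ') := by
  intro hnm hn hm P P' S hS α β hα hβ
  rcases Nat.lt_or_ge m 2 with hm2 | hm2
  · obtain rfl : m = 1 := by omega
    exact MoeglinWaldspurger1989_partialPairL_entire_of_rank_ne_gl_one_of_standard
      (fun Q _ hS' _ hγ => StandardEntire.stub_standard_entire_of_ssv Ssv.stub_ssv (by omega) Q hS' hγ)
      hnm hn hm P P' hS hα hβ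
  rcases Nat.lt_or_ge n 2 with hn2 | hn2
  · obtain rfl : n = 1 := by omega
    exact MoeglinWaldspurger1989_partialPairL_entire_of_rank_ne_of_swap
      (MoeglinWaldspurger1989_partialPairL_entire_of_rank_ne_gl_one_of_standard
        (fun Q _ hS' _ hγ => StandardEntire.stub_standard_entire_of_ssv Ssv.stub_ssv (by omega) Q hS' hγ))
      hnm hn hm P P' hS hα hβ
  exact hMW hn2 hm2 hnm hn hm P P' hS hα hβ

/-- **The crux `PairLBoundaryJS` (Arthur–Clozel (2.2) for Borel–Jacquet data, all ranks) from TWO named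
inputs**: Mœglin–Waldspurger (i)(a) for `2 ≤ n, m` (`hMW`) and the archimedean fact
`HumphriesJo2024_archRankinSelberg_testVector` (`hHJ`); everything else — the `(n,1)`/`(1,n)` slices of
(i)(a), Corollaire (ii), the orthogonal-pair continuation, and the Schur/Landau assembly
`PairLBoundaryJS_of_moeglinWaldspurger_of_isOrtho` — is proved in the tree.
[cite: ArthurClozelAMS120, Ch. 3 §2 (2.2)] [cite: JacquetShalikaAJM1981II, Prop. 3.6 and Thm. 4.4]
[cite: MoeglinWaldspurger1989, Appendice, Corollaire (i)(a), (i)(b), (ii), p. 667] -/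
theorem PairLBoundaryJS_of_rank_ne_two_le_of_humphriesJo :
    (∀ {n m : ℕ} {K : Type} [Field K] [NumberField K]
      {μ : Measure (gl n K).automorphicQuotient} [(gl n K).IsAutomorphicMeasure μ]
      {μ' : Measure (gl m K).automorphicQuotient} [(gl m K).IsAutomorphicMeasure μ'],
      2 ≤ n → 2 ≤ m →
      MoeglinWaldspurger1989_partialPairL_entire_of_rank_ne (n := n) (m := m) (K := K) (μ := μ) (μ' := μ')) →
    (∀ (N : ℕ) (K : Type) [Field K] [NumberField K], HumphriesJo2024_archRankinSelberg_testVector N K) →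
    Summit.Langlands.Langlands.Theses.IrreducibilityBySelfDuality.PairLBoundaryJS :=
  fun hMW hHJ =>
    PairLBoundaryJS_of_moeglinWaldspurger_of_isOrtho (partialPairL_entire_of_rank_ne_of_two_le hMW)
      (partialPairL_of_eq_conj_of_humphriesJo hHJ) (partialPairL_entire_of_isOrtho_of_humphriesJo hHJ)

end Summit.Langlands.Langlands.Theorems.PairLBoundaryJSOfHumphriesJo

end
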